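import Literature.Analysis.FunctionSpaces.BMOCarleson
import Literature.Analysis.UnboundedOperators.HeatKernel
import Mathlib.MeasureTheory.Measure.Lebesgue.EqHaar
import Mathlib.Analysis.SpecificLimits.Normed
import Mathlib.Analysis.Calculus.BumpFunction.FiniteDimension
import Mathlib.MeasureTheory.Integral.DominatedConvergence
import HarnessLib

/-!
# Koch–Tataru's Theorem 1: discharges of the intermediate facts

Topic `Analysis/FunctionSpaces`; proofs companion of
`Literature/Analysis/FunctionSpaces/BMOCarleson.lean`, which reduces the named fact
`Literature.Analysis.FunctionSpaces.memBMOInv_iff_carleson_heat` (Koch–Tataru 2001, Theorem 1) to five intermediate named facts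
(A)–(E). This file discharges

* **(A)** `Literature.Analysis.FunctionSpaces.MemBMO.integrable_inv_one_add_norm_pow_mul` — a `BMO` function is integrable
  against `(1 + ‖y‖)^{-(d+1)}` (Grafakos, *Modern Fourier Analysis*, 3rd ed., Prop. 3.1.5
  (i)–(ii)): `Literature.Analysis.FunctionSpaces.MemBMO.integrable_inv_one_add_norm_pow_mul_holds`, via the theorem
  `Literature.Analysis.FunctionSpaces.MemBMO.integrable_one_add_norm_pow_inv_mul`;
* **(C)** `Literature.Analysis.FunctionSpaces.heatExtension_eq_sum_inner_heatExtensionGrad` — the caloric extension of a weak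
  divergence, `e^{tΔ} div Φ (y) = Σᵢ ⟪∇e^{tΔ}Φᵢ (y), bᵢ⟫` (Koch–Tataru 2001, §4, proof of
  Theorem 1, first display): `Literature.Analysis.FunctionSpaces.heatExtension_eq_sum_inner_heatExtensionGrad_holds`, via the
  theorem `Literature.Analysis.FunctionSpaces.BMOInv.heatExtension_eq_sum_inner_heatExtensionGrad'`,

and records the assembly with (A) and (C) discharged, `Literature.Analysis.FunctionSpaces.memBMOInv_iff_carleson_heat_of_BDE`
(Koch–Tataru's Theorem 1 from (B), (D), (E): the two directions of the Fefferman–Stein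
Carleson characterisation of `BMO` and Koch–Tataru's converse in Carleson form — the
harmonic-analysis core, which remains as named facts).

## Proof of (A) (as printed in Grafakos, proof of Prop. 3.1.5)

* `MemBMO.abs_average_sub_average_le`: `|f_B - f_{B'}| ≤ |B|⁻¹ ‖f‖_* |B'|` for balls `B ⊆ B'`
  ((3.1.3));
* `MemBMO.abs_average_two_pow_sub_average_one_le`: telescoping, `|f_{B(0,2^k)} - f_{B(0,1)}| ≤
  k 2^d ‖f‖_*` (Prop. 3.1.5 (i));
* `MemBMO.lintegral_ball_two_pow_le`: `∫_{B(0,2^k)} |f| = O((1+k) 2^{kd})`;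
* summation over the dyadic shells `B(0,2^{k+1}) ∖ B(0,2^k)`, on which the weight is
  `≤ 2^{-k(d+1)}`: the series `Σ (A + Bk) 2^{-k}` converges.

## Proof of (C) (the calculus behind Koch–Tataru's first display of §4)

Fix `t > 0`, `y`. The weak identity `∫ u φ = -∫ ⟪Φ, ∇φ⟫` is tested with
`φ_n(z) = χ_n(z) K_t(y - z)`, `χ_n(z) = β(z/(n+1))` for a fixed bump `β` (`1` near `0`):
`∇φ_n = -χ_n ∇K_t(y - ·) + K_t(y - ·) ∇χ_n`. Gaussian-versus-polynomial bounds
(`exists_bound_weights_mul_heatKernel`: `(1+‖y-z‖²)^M (1+‖z‖²)^N K_t(y-z)` is bounded in `z`)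
make `u K_t(y-·)`, `‖Φ‖ K_t(y-·)` and `‖Φ‖ ‖∇K_t(y-·)‖` integrable under the growth hypotheses,
so dominated convergence (`χ_n → 1`, `∇χ_n → 0` pointwise, `‖∇χ_n‖ ≤ M`) gives
`∫ u K_t(y-·) = ∫ ⟪∇K_t(y - z), Φ z⟫ dz`, and expanding `Φ` in the orthonormal basis `(bᵢ)`
identifies the right-hand side with `Σᵢ ⟪∇e^{tΔ}⟪Φ, bᵢ⟫ (y), bᵢ⟫`.

## References

* L. Grafakos, *Modern Fourier Analysis*, 3rd ed., GTM 250 (2014), Prop. 3.1.5. [GrafakosMFA2014]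
* H. Koch, D. Tataru, *Well-posedness for the Navier–Stokes equations*, Adv. Math. 157 (2001),
  22–35, Theorem 1 and §4. [KochTataruAdvMath2001]
* L. C. Evans, *Partial Differential Equations*, §2.3.1 (the heat kernel).
-/

noncomputable section

open MeasureTheory Metric Filter Topology
open scoped ENNReal NNReal RealInnerProductSpace

namespace Literature.Analysis.FunctionSpaces

/-! ## Discharge of fact (A): growth of `BMO` functions (Grafakos Prop. 3.1.5) -/

section FactA

variable {E : Type*} [NormedAddCommGroup E] [InnerProductSpace ℝ E] [FiniteDimensional ℝ E]
  [MeasurableSpace E] [BorelSpace E]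

namespace MemBMO

/-- A `BMO` function is integrable on every ball (Grafakos MFA3 §3.1: `BMO ⊂ L¹_loc`). [folklore] -/
theorem integrableOn_ball {f : E → ℝ} (hf : MemBMO f) (x : E) (r : ℝ) :
    IntegrableOn f (ball x r) :=
  (hf.1.integrableOn_isCompact (isCompact_closedBall x r)).mono_set ball_subset_closedBall

/-- The defining oscillation bound in integrated form: `∫_B |f - f_B| ≤ ‖f‖_* |B|`
(Grafakos MFA3, Definition 3.1.1 / (3.1.2) for balls). [folklore] -/
theorem setIntegral_norm_sub_average_le {f : E → ℝ} (hf : MemBMO f) (x : E) {r : ℝ}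
    (hr : 0 < r) :
    ∫ y in ball x r, ‖f y - ⨍ z in ball x r, f z‖ ≤
      (eBMOSeminorm f).toReal * volume.real (ball x r) := by
  have hB0 : volume (ball x r) ≠ 0 := (measure_ball_pos volume x hr).ne'
  have hBtop : volume (ball x r) ≠ ∞ := measure_ball_lt_top.ne
  have h1 : ∫⁻ y in ball x r, ‖f y - ⨍ z in ball x r, f z‖ₑ ≤
      eBMOSeminorm f * volume (ball x r) := by
    have := laverage_oscillation_le_eBMOSeminorm f volume x hr
    rwa [setLAverage_eq, ENNReal.div_le_iff hB0 hBtop] at this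
  have hmeas : AEStronglyMeasurable (fun y => f y - ⨍ z in ball x r, f z)
      (volume.restrict (ball x r)) :=
    (hf.1.aestronglyMeasurable.sub aestronglyMeasurable_const).restrict
  rw [integral_norm_eq_lintegral_enorm hmeas, measureReal_def, ← ENNReal.toReal_mul]
  exact ENNReal.toReal_mono (ENNReal.mul_ne_top hf.2.ne hBtop) h1

/-- `∫_B |f| ≤ (‖f‖_* + |f_B|) |B|` (triangle inequality). [folklore] -/
theorem setIntegral_norm_le {f : E → ℝ} (hf : MemBMO f) (x : E) {r : ℝ} (hr : 0 < r) :
    ∫ y in ball x r, ‖f y‖ ≤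
      ((eBMOSeminorm f).toReal + ‖⨍ z in ball x r, f z‖) * volume.real (ball x r) := by
  have hint := hf.integrableOn_ball x r
  have hBtop : volume (ball x r) ≠ ∞ := measure_ball_lt_top.ne
  have hconst : IntegrableOn (fun _ : E => ‖⨍ z in ball x r, f z‖) (ball x r) :=
    integrableOn_const hBtop enorm_ne_top
  have hconst' : IntegrableOn (fun _ : E => ⨍ z in ball x r, f z) (ball x r) :=
    integrableOn_const hBtop enorm_ne_top
  have hsub : IntegrableOn (fun y => ‖f y - ⨍ z in ball x r, f z‖) (ball x r) :=
    (hint.sub hconst').norm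
  have h1 : ∫ y in ball x r, ‖f y‖ ≤
      ∫ y in ball x r, (‖f y - ⨍ z in ball x r, f z‖ + ‖⨍ z in ball x r, f z‖) :=
    integral_mono hint.norm (hsub.add hconst) fun y => by
      simpa [add_comm] using norm_le_insert' (f y) (⨍ z in ball x r, f z)
  have h2 : ∫ y in ball x r, (‖f y - ⨍ z in ball x r, f z‖ + ‖⨍ z in ball x r, f z‖) =
      (∫ y in ball x r, ‖f y - ⨍ z in ball x r, f z‖) +
        ‖⨍ z in ball x r, f z‖ * volume.real (ball x r) := by
    rw [integral_add hsub hconst, setIntegral_const, smul_eq_mul, mul_comm]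
  have h3 := hf.setIntegral_norm_sub_average_le x hr
  rw [h2] at h1
  linarith

/-- Averages over nested balls: `|f_B - f_{B'}| ≤ |B|⁻¹ ‖f‖_* |B'|` for `B ⊆ B'`
(Grafakos, *Modern Fourier Analysis*, 3rd ed., (3.1.3), "the same estimate holds if the sets are
balls"). [cite: GrafakosMFA2014, (3.1.3)] -/
theorem abs_average_sub_average_le {f : E → ℝ} (hf : MemBMO f) {x x' : E} {r r' : ℝ}
    (hr : 0 < r) (hr' : 0 < r') (hsub : ball x r ⊆ ball x' r') :
    |(⨍ z in ball x r, f z) - ⨍ z in ball x' r', f z| ≤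
      (volume.real (ball x r))⁻¹ *
        ((eBMOSeminorm f).toReal * volume.real (ball x' r')) := by
  have hB0 : volume (ball x r) ≠ 0 := (measure_ball_pos volume x hr).ne'
  have hBtop : volume (ball x r) ≠ ∞ := measure_ball_lt_top.ne
  have hVpos : 0 < volume.real (ball x r) := ENNReal.toReal_pos hB0 hBtop
  have hint : IntegrableOn f (ball x r) := hf.integrableOn_ball x r
  have hint' : IntegrableOn f (ball x' r') := hf.integrableOn_ball x' r'
  have hconst : IntegrableOn (fun _ : E => ⨍ z in ball x' r', f z) (ball x r) :=
    integrableOn_const hBtop enorm_ne_top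
  have hconst2 : IntegrableOn (fun _ : E => ⨍ z in ball x' r', f z) (ball x' r') :=
    integrableOn_const measure_ball_lt_top.ne enorm_ne_top
  have h1 : (⨍ z in ball x r, f z) - ⨍ z in ball x' r', f z =
      (volume.real (ball x r))⁻¹ * ∫ z in ball x r, (f z - ⨍ z in ball x' r', f z) := by
    rw [setAverage_eq, integral_sub hint hconst, setIntegral_const, smul_eq_mul, smul_eq_mul]
    field_simp
  rw [h1, abs_mul, abs_inv, abs_of_pos hVpos]
  gcongr
  have h2 : |∫ z in ball x r, (f z - ⨍ z in ball x' r', f z)| ≤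
      ∫ z in ball x r, |f z - ⨍ z in ball x' r', f z| := abs_integral_le_integral_abs
  have h3 : ∫ z in ball x r, |f z - ⨍ z in ball x' r', f z| ≤
      ∫ z in ball x' r', |f z - ⨍ z in ball x' r', f z| :=
    setIntegral_mono_set (hint'.sub hconst2).abs (Eventually.of_forall fun z => abs_nonneg _)
      hsub.eventuallyLE
  have h4 : ∫ z in ball x' r', |f z - ⨍ z in ball x' r', f z| ≤
      (eBMOSeminorm f).toReal * volume.real (ball x' r') := by
    simpa [Real.norm_eq_abs] using hf.setIntegral_norm_sub_average_le x' hr'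
  exact h2.trans (h3.trans h4)

end MemBMO

/-- Doubling of the Haar volume of balls: `|B(x, 2r)| = 2^d |B(x, r)|`. [folklore] -/
theorem volumeReal_ball_two_mul (x : E) {r : ℝ} (hr : 0 < r) :
    volume.real (ball x (2 * r)) = 2 ^ Module.finrank ℝ E * volume.real (ball x r) := by
  rw [measureReal_def, measureReal_def, Measure.addHaar_ball_of_pos _ x hr,
    Measure.addHaar_ball_of_pos _ x (by positivity),
    ENNReal.toReal_mul, ENNReal.toReal_mul, ENNReal.toReal_ofReal (by positivity),
    ENNReal.toReal_ofReal (by positivity), mul_pow]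
  ring

/-- Volume of the dyadic balls: `|B(0, 2^k)| = 2^{kd} |B(0,1)|`. [folklore] -/
theorem volumeReal_ball_two_pow (k : ℕ) :
    volume.real (ball (0 : E) (2 ^ k)) =
      (2 ^ k) ^ Module.finrank ℝ E * volume.real (ball (0 : E) 1) := by
  rw [measureReal_def, measureReal_def,
    Measure.addHaar_ball_of_pos _ (0 : E) (by positivity : (0 : ℝ) < 2 ^ k),
    ENNReal.toReal_mul, ENNReal.toReal_ofReal (by positivity)]

namespace MemBMO

/-- One dyadic step: `|f_{B(0,2^{k+1})} - f_{B(0,2^k)}| ≤ 2^d ‖f‖_*` (Grafakos, *Modern Fourier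
Analysis*, 3rd ed., proof of Prop. 3.1.5 (i)). [cite: GrafakosMFA2014, Proposition 3.1.5 (i)] -/
theorem abs_average_two_pow_succ_sub_le {f : E → ℝ} (hf : MemBMO f) (k : ℕ) :
    |(⨍ z in ball (0 : E) (2 ^ (k + 1)), f z) - ⨍ z in ball (0 : E) (2 ^ k), f z| ≤
      2 ^ Module.finrank ℝ E * (eBMOSeminorm f).toReal := by
  have h2k : (0 : ℝ) < 2 ^ k := by positivity
  have h := hf.abs_average_sub_average_le (x := 0) (x' := 0) h2k (by positivity : (0:ℝ) < 2 ^ (k + 1))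
    (ball_subset_ball (pow_le_pow_right₀ one_le_two (Nat.le_succ k)))
  rw [abs_sub_comm] at h
  refine h.trans_eq ?_
  have hV : 0 < volume.real (ball (0 : E) (2 ^ k)) :=
    ENNReal.toReal_pos (measure_ball_pos volume _ h2k).ne' measure_ball_lt_top.ne
  rw [pow_succ', volumeReal_ball_two_mul (0 : E) h2k]
  field_simp

/-- Telescoping over dyadic balls: `|f_{B(0,2^k)} - f_{B(0,1)}| ≤ k 2^d ‖f‖_*` (Grafakos, *Modern
Fourier Analysis*, 3rd ed., Prop. 3.1.5 (i), (3.1.4) with `B = B(0,1)`, `m = k`). [cite: GrafakosMFA2014, Proposition 3.1.5 (i)] -/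
theorem abs_average_two_pow_sub_average_one_le {f : E → ℝ} (hf : MemBMO f) (k : ℕ) :
    |(⨍ z in ball (0 : E) (2 ^ k), f z) - ⨍ z in ball (0 : E) 1, f z| ≤
      k * (2 ^ Module.finrank ℝ E * (eBMOSeminorm f).toReal) := by
  induction k with
  | zero => simp
  | succ k ih =>
    have h1 := abs_sub_le (⨍ z in ball (0 : E) (2 ^ (k + 1)), f z)
      (⨍ z in ball (0 : E) (2 ^ k), f z) (⨍ z in ball (0 : E) 1, f z)
    have h2 := hf.abs_average_two_pow_succ_sub_le k
    push_cast
    linarith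

/-- Mass of a `BMO` function on dyadic balls:
`∫_{B(0,2^k)} |f| ≤ (‖f‖_* + |f_{B(0,1)}| + k 2^d ‖f‖_*) 2^{kd} |B(0,1)|` (Grafakos, *Modern Fourier
Analysis*, 3rd ed., proof of Prop. 3.1.5 (ii), the bound on `∫_{2^{k+1}B}`). [cite: GrafakosMFA2014, Proposition 3.1.5 (ii), proof] -/
theorem lintegral_ball_two_pow_le {f : E → ℝ} (hf : MemBMO f) (k : ℕ) :
    ∫⁻ y in ball (0 : E) (2 ^ k), ‖f y‖ₑ ≤ ENNReal.ofReal
      (((eBMOSeminorm f).toReal + (‖⨍ z in ball (0 : E) 1, f z‖ +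
          k * (2 ^ Module.finrank ℝ E * (eBMOSeminorm f).toReal))) *
        ((2 ^ k) ^ Module.finrank ℝ E * volume.real (ball (0 : E) 1))) := by
  rw [← ofReal_integral_norm_eq_lintegral_enorm (hf.integrableOn_ball 0 _)]
  refine ENNReal.ofReal_le_ofReal ?_
  rw [← volumeReal_ball_two_pow]
  refine (hf.setIntegral_norm_le 0 (by positivity)).trans ?_
  have hV : 0 ≤ volume.real (ball (0 : E) (2 ^ k)) := measureReal_nonneg
  gcongr
  have h1 := norm_le_insert' (⨍ z in ball (0 : E) (2 ^ k), f z) (⨍ z in ball (0 : E) 1, f z)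
  have h2 := hf.abs_average_two_pow_sub_average_one_le k
  rw [← Real.norm_eq_abs] at h2
  linarith

omit [InnerProductSpace ℝ E] [FiniteDimensional ℝ E] [MeasurableSpace E] [BorelSpace E] in
/-- The weight on the `k`-th dyadic shell: `(1+‖y‖)^{-(d+1)} ≤ 2^{-k(d+1)}` if `‖y‖ ≥ 2^k`. [folklore] -/
theorem weight_le_of_le_norm {d k : ℕ} {y : E} (hy : (2 : ℝ) ^ k ≤ ‖y‖) :
    ((1 + ‖y‖) ^ (d + 1))⁻¹ ≤ (((2 : ℝ) ^ k) ^ (d + 1))⁻¹ := by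
  have h2k : (0 : ℝ) < 2 ^ k := by positivity
  gcongr
  linarith

/-- Algebra of the shell estimate: `2^{-k(d+1)} (S + A₀ + (k+1)2^dS) 2^{(k+1)d} V = (A + Bk) 2^{-k}`. [folklore] -/
theorem shell_algebra (d k : ℕ) (S A₀ V : ℝ) :
    (((2 : ℝ) ^ k) ^ (d + 1))⁻¹ * ((S + (A₀ + ((k + 1 : ℕ) : ℝ) * (2 ^ d * S))) *
        ((2 ^ (k + 1)) ^ d * V)) =
      (2 ^ d * V * (S + A₀ + 2 ^ d * S) + 2 ^ d * V * (2 ^ d * S) * k) * (1 / 2 : ℝ) ^ k := by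
  have h2k : (2 : ℝ) ^ k ≠ 0 := by positivity
  rw [one_div, inv_pow, pow_succ' (2 : ℝ) k, mul_pow, Nat.cast_add, Nat.cast_one]
  field_simp
  ring

/-- Summability of the shell series `Σ (A + B k) 2^{-k}`. [folklore] -/
theorem summable_shell (A B : ℝ) : Summable fun k : ℕ => (A + B * k) * (1 / 2 : ℝ) ^ k := by
  have h1 : Summable fun k : ℕ => A * (1 / 2 : ℝ) ^ k :=
    (summable_geometric_of_lt_one (by norm_num) (by norm_num)).mul_left A
  have h2 : Summable fun k : ℕ => B * ((k : ℝ) ^ 1 * (1 / 2 : ℝ) ^ k) :=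
    (summable_pow_mul_geometric_of_norm_lt_one 1 (by norm_num)).mul_left B
  refine (h1.add h2).congr fun k => ?_
  ring

/-- **Growth of `BMO` functions** (fact (A) as a theorem): a `BMO` function on `E` is integrable
against `(1 + ‖y‖)^{-(d+1)}` (Grafakos, *Modern Fourier Analysis*, 3rd ed., Prop. 3.1.5 (ii) with
`δ = 1`, `B = B(0,1)`; proof as printed there: split `E` into `B(0,1)` and the dyadic shells
`B(0,2^{k+1}) ∖ B(0,2^k)`, on which the weight is `≤ 2^{-k(d+1)}` and the mass of `f` is
`O(k 2^{(k+1)d})` by `lintegral_ball_two_pow_le`; the resulting series `Σ (A + Bk)2^{-k}` converges). [cite: GrafakosMFA2014, Proposition 3.1.5 (ii)] -/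
theorem integrable_one_add_norm_pow_inv_mul {f : E → ℝ} (hf : MemBMO f) :
    Integrable fun y => ((1 + ‖y‖) ^ (Module.finrank ℝ E + 1))⁻¹ * f y := by
  have hw_nonneg : ∀ y : E, 0 ≤ ((1 + ‖y‖) ^ (Module.finrank ℝ E + 1))⁻¹ := fun y =>
    inv_nonneg.mpr (pow_nonneg (by linarith [norm_nonneg y]) _)
  have hw_le_one : ∀ y : E, ((1 + ‖y‖) ^ (Module.finrank ℝ E + 1))⁻¹ ≤ 1 := fun y => by
    refine inv_le_one_of_one_le₀ (one_le_pow₀ ?_)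
    linarith [norm_nonneg y]
  -- measurability
  have hmeas : AEStronglyMeasurable
      (fun y : E => ((1 + ‖y‖) ^ (Module.finrank ℝ E + 1))⁻¹ * f y) volume := by
    refine (Continuous.aestronglyMeasurable ?_).mul hf.1.aestronglyMeasurable
    have hc : Continuous fun y : E => (1 + ‖y‖) ^ (Module.finrank ℝ E + 1) :=
      (continuous_const.add continuous_norm).pow _
    exact hc.inv₀ fun y => (pow_pos (by linarith [norm_nonneg y]) _).ne'
  refine ⟨hmeas, ?_⟩
  rw [hasFiniteIntegral_iff_enorm]
  -- constants of the shell series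
  obtain ⟨S, hS⟩ : ∃ S : ℝ, S = (eBMOSeminorm f).toReal := ⟨_, rfl⟩
  obtain ⟨A₀, hA₀⟩ : ∃ A₀ : ℝ, A₀ = ‖⨍ z in ball (0 : E) 1, f z‖ := ⟨_, rfl⟩
  obtain ⟨V, hV⟩ : ∃ V : ℝ, V = volume.real (ball (0 : E) 1) := ⟨_, rfl⟩
  obtain ⟨A, hA⟩ : ∃ A : ℝ,
    A = 2 ^ Module.finrank ℝ E * V * (S + A₀ + 2 ^ Module.finrank ℝ E * S) := ⟨_, rfl⟩
  obtain ⟨B, hB⟩ : ∃ B : ℝ,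
    B = 2 ^ Module.finrank ℝ E * V * (2 ^ Module.finrank ℝ E * S) := ⟨_, rfl⟩
  have hS0 : 0 ≤ S := hS ▸ ENNReal.toReal_nonneg
  have hV0 : 0 ≤ V := hV ▸ measureReal_nonneg
  have hA00 : 0 ≤ A₀ := hA₀ ▸ norm_nonneg _
  have hA_nonneg : 0 ≤ A := hA ▸ by positivity
  have hB_nonneg : 0 ≤ B := hB ▸ by positivity
  have hterm_nonneg : ∀ k : ℕ, 0 ≤ (A + B * k) * (1 / 2 : ℝ) ^ k := fun k => by positivity
  -- the dyadic shells cover the complement of the unit ball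
  have hcover : (Set.univ : Set E) ⊆
      ball 0 1 ∪ ⋃ k : ℕ, (ball (0 : E) (2 ^ (k + 1)) \ ball (0 : E) (2 ^ k)) := by
    intro y _
    by_cases hy : ‖y‖ < 1
    · exact Or.inl (mem_ball_zero_iff.mpr hy)
    · right
      obtain ⟨k, hk1, hk2⟩ := exists_nat_pow_near (not_lt.mp hy) one_lt_two
      exact Set.mem_iUnion.mpr ⟨k, mem_ball_zero_iff.mpr hk2,
        fun h => (not_le.mpr (mem_ball_zero_iff.mp h)) hk1⟩
  -- shell estimate
  have hshell : ∀ k : ℕ,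
      ∫⁻ y in ball (0 : E) (2 ^ (k + 1)) \ ball (0 : E) (2 ^ k),
          ‖((1 + ‖y‖) ^ (Module.finrank ℝ E + 1))⁻¹ * f y‖ₑ ≤
        ENNReal.ofReal ((A + B * k) * (1 / 2 : ℝ) ^ k) := by
    intro k
    have hck : 0 ≤ (((2 : ℝ) ^ k) ^ (Module.finrank ℝ E + 1))⁻¹ := by positivity
    calc ∫⁻ y in ball (0 : E) (2 ^ (k + 1)) \ ball (0 : E) (2 ^ k),
          ‖((1 + ‖y‖) ^ (Module.finrank ℝ E + 1))⁻¹ * f y‖ₑ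
        ≤ ∫⁻ y in ball (0 : E) (2 ^ (k + 1)) \ ball (0 : E) (2 ^ k),
            ENNReal.ofReal ((((2 : ℝ) ^ k) ^ (Module.finrank ℝ E + 1))⁻¹) * ‖f y‖ₑ := by
          refine setLIntegral_mono' (measurableSet_ball.diff measurableSet_ball) fun y hy => ?_
          rw [enorm_mul, Real.enorm_of_nonneg (hw_nonneg y)]
          have hy' : (2 : ℝ) ^ k ≤ ‖y‖ := by
            have := hy.2
            rwa [mem_ball_zero_iff, not_lt] at this
          have h2k : (0 : ℝ) < 2 ^ k := by positivity
          gcongr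
          linarith
      _ ≤ ∫⁻ y in ball (0 : E) (2 ^ (k + 1)),
            ENNReal.ofReal ((((2 : ℝ) ^ k) ^ (Module.finrank ℝ E + 1))⁻¹) * ‖f y‖ₑ :=
          lintegral_mono_set Set.sdiff_subset
      _ = ENNReal.ofReal ((((2 : ℝ) ^ k) ^ (Module.finrank ℝ E + 1))⁻¹) *
            ∫⁻ y in ball (0 : E) (2 ^ (k + 1)), ‖f y‖ₑ :=
          lintegral_const_mul' _ _ ENNReal.ofReal_ne_top
      _ ≤ ENNReal.ofReal ((((2 : ℝ) ^ k) ^ (Module.finrank ℝ E + 1))⁻¹) * ENNReal.ofReal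
          ((S + (A₀ + ((k + 1 : ℕ) : ℝ) * (2 ^ Module.finrank ℝ E * S))) *
            ((2 ^ (k + 1)) ^ Module.finrank ℝ E * V)) := by
          gcongr
          rw [hS, hA₀, hV]
          exact hf.lintegral_ball_two_pow_le (k + 1)
      _ = ENNReal.ofReal ((A + B * k) * (1 / 2 : ℝ) ^ k) := by
          rw [← ENNReal.ofReal_mul hck, shell_algebra, hA, hB]
  -- the unit ball
  have hball0 : ∫⁻ y in ball (0 : E) 1, ‖((1 + ‖y‖) ^ (Module.finrank ℝ E + 1))⁻¹ * f y‖ₑ < ∞ := by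
    calc ∫⁻ y in ball (0 : E) 1, ‖((1 + ‖y‖) ^ (Module.finrank ℝ E + 1))⁻¹ * f y‖ₑ
        ≤ ∫⁻ y in ball (0 : E) 1, ‖f y‖ₑ := by
          refine lintegral_mono fun y => ?_
          rw [enorm_mul, Real.enorm_of_nonneg (hw_nonneg y)]
          calc ENNReal.ofReal (((1 + ‖y‖) ^ (Module.finrank ℝ E + 1))⁻¹) * ‖f y‖ₑ
              ≤ 1 * ‖f y‖ₑ := by
                gcongr
                exact ENNReal.ofReal_le_one.mpr (hw_le_one y)
            _ = ‖f y‖ₑ := one_mul _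
      _ < ∞ := (hf.integrableOn_ball 0 1).2
  -- assemble
  calc ∫⁻ y, ‖((1 + ‖y‖) ^ (Module.finrank ℝ E + 1))⁻¹ * f y‖ₑ
      = ∫⁻ y in Set.univ, ‖((1 + ‖y‖) ^ (Module.finrank ℝ E + 1))⁻¹ * f y‖ₑ := by
        rw [Measure.restrict_univ]
    _ ≤ ∫⁻ y in ball 0 1 ∪ ⋃ k : ℕ, (ball (0 : E) (2 ^ (k + 1)) \ ball (0 : E) (2 ^ k)),
          ‖((1 + ‖y‖) ^ (Module.finrank ℝ E + 1))⁻¹ * f y‖ₑ := lintegral_mono_set hcover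
    _ ≤ (∫⁻ y in ball (0 : E) 1, ‖((1 + ‖y‖) ^ (Module.finrank ℝ E + 1))⁻¹ * f y‖ₑ) +
          ∫⁻ y in ⋃ k : ℕ, (ball (0 : E) (2 ^ (k + 1)) \ ball (0 : E) (2 ^ k)),
            ‖((1 + ‖y‖) ^ (Module.finrank ℝ E + 1))⁻¹ * f y‖ₑ :=
        lintegral_union_le _ _ _
    _ ≤ (∫⁻ y in ball (0 : E) 1, ‖((1 + ‖y‖) ^ (Module.finrank ℝ E + 1))⁻¹ * f y‖ₑ) +
          ∑' k : ℕ, ∫⁻ y in ball (0 : E) (2 ^ (k + 1)) \ ball (0 : E) (2 ^ k),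
            ‖((1 + ‖y‖) ^ (Module.finrank ℝ E + 1))⁻¹ * f y‖ₑ := by
        gcongr
        exact lintegral_iUnion_le _ _
    _ ≤ (∫⁻ y in ball (0 : E) 1, ‖((1 + ‖y‖) ^ (Module.finrank ℝ E + 1))⁻¹ * f y‖ₑ) +
          ∑' k : ℕ, ENNReal.ofReal ((A + B * k) * (1 / 2 : ℝ) ^ k) := by
        exact add_le_add le_rfl (ENNReal.tsum_le_tsum hshell)
    _ = (∫⁻ y in ball (0 : E) 1, ‖((1 + ‖y‖) ^ (Module.finrank ℝ E + 1))⁻¹ * f y‖ₑ) +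
          ENNReal.ofReal (∑' k : ℕ, (A + B * k) * (1 / 2 : ℝ) ^ k) := by
        rw [ENNReal.ofReal_tsum_of_nonneg hterm_nonneg (summable_shell A B)]
    _ < ∞ := ENNReal.add_lt_top.mpr ⟨hball0, ENNReal.ofReal_lt_top⟩

end MemBMO


/-- **Discharge of fact (A)** `MemBMO.integrable_inv_one_add_norm_pow_mul`
(Grafakos, *Modern Fourier Analysis*, 3rd ed., Prop. 3.1.5 (ii)). [cite: GrafakosMFA2014, Proposition 3.1.5 (ii)] -/
theorem MemBMO.integrable_inv_one_add_norm_pow_mul_holds :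
    MemBMO.integrable_inv_one_add_norm_pow_mul (E := E) :=
  fun hf => hf.integrable_one_add_norm_pow_inv_mul

end FactA

namespace BMOInv

/-! ## Discharge of fact (C): the caloric extension of a divergence

### Gaussian versus polynomial weights -/

section Decay

variable {E : Type*} [NormedAddCommGroup E] [InnerProductSpace ℝ E]

/-- The heat kernel is smooth in space. [folklore] -/
theorem contDiff_heatKernel (t : ℝ) {n : WithTop ℕ∞} : ContDiff ℝ n (heatKernel (E := E) t) := by
  unfold heatKernel
  exact contDiff_const.mul (Real.contDiff_exp.comp (((contDiff_norm_sq ℝ).neg).div_const _))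

omit [InnerProductSpace ℝ E] in
/-- `1 + ‖z‖² ≤ 2 (1 + ‖y‖²)(1 + ‖y - z‖²)` (Peetre-type inequality). [folklore] -/
theorem one_add_norm_sq_le [NormedSpace ℝ E] (y z : E) :
    1 + ‖z‖ ^ 2 ≤ 2 * (1 + ‖y‖ ^ 2) * (1 + ‖y - z‖ ^ 2) := by
  have h1 : ‖z‖ ≤ ‖y‖ + ‖y - z‖ := by
    have := norm_sub_le y (y - z)
    rwa [sub_sub_cancel] at this
  have h2 : ‖z‖ ^ 2 ≤ (‖y‖ + ‖y - z‖) ^ 2 := by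
    gcongr
  nlinarith [norm_nonneg y, norm_nonneg (y - z), sq_nonneg (‖y‖ - ‖y - z‖),
    mul_nonneg (sq_nonneg ‖y‖) (sq_nonneg ‖y - z‖)]

/-- `(1 + s)^n ≤ 2^n (1 + s^n)` for `s ≥ 0`. [folklore] -/
theorem one_add_pow_le_two_pow_mul {s : ℝ} (hs : 0 ≤ s) (n : ℕ) :
    (1 + s) ^ n ≤ 2 ^ n * (1 + s ^ n) := by
  rcases le_total s 1 with h | h
  · have h1 : (1 + s) ^ n ≤ 2 ^ n := pow_le_pow_left₀ (by positivity) (by linarith) n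
    have h2 : (2 : ℝ) ^ n ≤ 2 ^ n * (1 + s ^ n) :=
      le_mul_of_one_le_right (by positivity) (by linarith [pow_nonneg hs n])
    exact h1.trans h2
  · have h1 : (1 + s) ^ n ≤ (2 * s) ^ n := pow_le_pow_left₀ (by positivity) (by linarith) n
    rw [mul_pow] at h1
    have h2 : (2 : ℝ) ^ n * s ^ n ≤ 2 ^ n * (1 + s ^ n) := by
      gcongr
      linarith
    exact h1.trans h2

/-- `s^n e^{-as} ≤ n! / a^n` for `s ≥ 0`, `a > 0`. [folklore] -/
theorem pow_mul_exp_neg_le {a : ℝ} (ha : 0 < a) (n : ℕ) {s : ℝ} (hs : 0 ≤ s) :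
    s ^ n * Real.exp (-(a * s)) ≤ n.factorial / a ^ n := by
  have h := Real.pow_div_factorial_le_exp (a * s) (by positivity) n
  rw [div_le_iff₀ (by positivity)] at h
  have h1 : s ^ n * Real.exp (-(a * s)) = ((a * s) ^ n * Real.exp (-(a * s))) / a ^ n := by
    rw [mul_pow]
    field_simp
  rw [h1, div_le_div_iff_of_pos_right (by positivity)]
  calc (a * s) ^ n * Real.exp (-(a * s))
      ≤ (Real.exp (a * s) * n.factorial) * Real.exp (-(a * s)) := by gcongr
    _ = n.factorial := by
        rw [mul_comm (Real.exp _), mul_assoc, ← Real.exp_add, add_neg_cancel, Real.exp_zero,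
          mul_one]

/-- `(1 + s)^n e^{-as} ≤ 2^n (1 + n!/a^n)` for `s ≥ 0`, `a > 0`. [folklore] -/
theorem one_add_pow_mul_exp_neg_le {a : ℝ} (ha : 0 < a) (n : ℕ) {s : ℝ} (hs : 0 ≤ s) :
    (1 + s) ^ n * Real.exp (-(a * s)) ≤ 2 ^ n * (1 + n.factorial / a ^ n) := by
  have h1 := one_add_pow_le_two_pow_mul hs n
  have h2 := pow_mul_exp_neg_le ha n hs
  have h3 : Real.exp (-(a * s)) ≤ 1 := Real.exp_le_one_iff.mpr (by nlinarith)
  have h4 : (1 + s) ^ n * Real.exp (-(a * s)) ≤ 2 ^ n * (1 + s ^ n) * Real.exp (-(a * s)) := by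
    gcongr
  have h5 : 2 ^ n * (1 + s ^ n) * Real.exp (-(a * s)) =
      2 ^ n * (Real.exp (-(a * s)) + s ^ n * Real.exp (-(a * s))) := by ring
  rw [h5] at h4
  have h6 : (2 : ℝ) ^ n * (Real.exp (-(a * s)) + s ^ n * Real.exp (-(a * s))) ≤
      2 ^ n * (1 + n.factorial / a ^ n) := by
    gcongr
  exact h4.trans h6

/-- **Gaussian versus polynomial weights**: for `t > 0` and fixed `y`,
`(1 + ‖y - z‖²)^M (1 + ‖z‖²)^N K_t(y - z)` is bounded in `z`. [folklore] -/
theorem exists_bound_weights_mul_heatKernel [FiniteDimensional ℝ E] {t : ℝ} (ht : 0 < t) (y : E)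
    (M N : ℕ) :
    ∃ C : ℝ, ∀ z : E,
      (1 + ‖y - z‖ ^ 2) ^ M * (1 + ‖z‖ ^ 2) ^ N * heatKernel t (y - z) ≤ C := by
  refine ⟨(4 * Real.pi * t) ^ (-(Module.finrank ℝ E : ℝ) / 2) * (2 ^ N * (1 + ‖y‖ ^ 2) ^ N) *
    (2 ^ (M + N) * (1 + (M + N).factorial / (1 / (4 * t)) ^ (M + N))), fun z => ?_⟩
  have hs : 0 ≤ ‖y - z‖ ^ 2 := by positivity
  have hz : (1 + ‖z‖ ^ 2) ^ N ≤ (2 * (1 + ‖y‖ ^ 2) * (1 + ‖y - z‖ ^ 2)) ^ N :=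
    pow_le_pow_left₀ (by positivity) (one_add_norm_sq_le y z) N
  have key := one_add_pow_mul_exp_neg_le (a := 1 / (4 * t)) (by positivity) (M + N) hs
  have harg : -‖y - z‖ ^ 2 / (4 * t) = -(1 / (4 * t) * ‖y - z‖ ^ 2) := by ring
  have hc : 0 < (4 * Real.pi * t) ^ (-(Module.finrank ℝ E : ℝ) / 2) := by positivity
  unfold heatKernel
  rw [harg]
  have h1 : (1 + ‖y - z‖ ^ 2) ^ M * (1 + ‖z‖ ^ 2) ^ N *
      ((4 * Real.pi * t) ^ (-(Module.finrank ℝ E : ℝ) / 2) *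
        Real.exp (-(1 / (4 * t) * ‖y - z‖ ^ 2))) ≤
      (1 + ‖y - z‖ ^ 2) ^ M * (2 * (1 + ‖y‖ ^ 2) * (1 + ‖y - z‖ ^ 2)) ^ N *
      ((4 * Real.pi * t) ^ (-(Module.finrank ℝ E : ℝ) / 2) *
        Real.exp (-(1 / (4 * t) * ‖y - z‖ ^ 2))) := by
    gcongr
  have h2 : (1 + ‖y - z‖ ^ 2) ^ M * (2 * (1 + ‖y‖ ^ 2) * (1 + ‖y - z‖ ^ 2)) ^ N *
      ((4 * Real.pi * t) ^ (-(Module.finrank ℝ E : ℝ) / 2) *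
        Real.exp (-(1 / (4 * t) * ‖y - z‖ ^ 2))) =
      (4 * Real.pi * t) ^ (-(Module.finrank ℝ E : ℝ) / 2) * (2 ^ N * (1 + ‖y‖ ^ 2) ^ N) *
      ((1 + ‖y - z‖ ^ 2) ^ (M + N) * Real.exp (-(1 / (4 * t) * ‖y - z‖ ^ 2))) := by
    rw [pow_add, mul_pow, mul_pow]
    ring
  rw [h2] at h1
  have h3 : (4 * Real.pi * t) ^ (-(Module.finrank ℝ E : ℝ) / 2) * (2 ^ N * (1 + ‖y‖ ^ 2) ^ N) *
      ((1 + ‖y - z‖ ^ 2) ^ (M + N) * Real.exp (-(1 / (4 * t) * ‖y - z‖ ^ 2))) ≤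
      (4 * Real.pi * t) ^ (-(Module.finrank ℝ E : ℝ) / 2) * (2 ^ N * (1 + ‖y‖ ^ 2) ^ N) *
      (2 ^ (M + N) * (1 + (M + N).factorial / (1 / (4 * t)) ^ (M + N))) := by
    gcongr
  exact h1.trans h3

omit [InnerProductSpace ℝ E] in
/-- `(1 + ‖z‖)^N ≤ 2^N (1 + ‖z‖²)^N`. [folklore] -/
theorem one_add_norm_pow_le [NormedSpace ℝ E] (z : E) (N : ℕ) :
    (1 + ‖z‖) ^ N ≤ 2 ^ N * (1 + ‖z‖ ^ 2) ^ N := by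
  have h0 : 0 ≤ ‖z‖ := norm_nonneg z
  have h1 : (1 + ‖z‖) ^ 2 ≤ 2 * (1 + ‖z‖ ^ 2) := by nlinarith [sq_nonneg (‖z‖ - 1)]
  have h2 : (1 + ‖z‖) ≤ (1 + ‖z‖) ^ 2 := by nlinarith
  calc (1 + ‖z‖) ^ N ≤ ((1 + ‖z‖) ^ 2) ^ N := pow_le_pow_left₀ (by positivity) h2 N
    _ ≤ (2 * (1 + ‖z‖ ^ 2)) ^ N := pow_le_pow_left₀ (by positivity) h1 N
    _ = 2 ^ N * (1 + ‖z‖ ^ 2) ^ N := mul_pow _ _ _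

/-- For `t > 0` and fixed `y`, `(1 + ‖z‖)^N K_t(y - z)` is bounded in `z`. [folklore] -/
theorem exists_bound_one_add_norm_pow_mul_heatKernel [FiniteDimensional ℝ E] {t : ℝ} (ht : 0 < t)
    (y : E) (N : ℕ) :
    ∃ C : ℝ, ∀ z : E, (1 + ‖z‖) ^ N * heatKernel t (y - z) ≤ C := by
  obtain ⟨C, hC⟩ := exists_bound_weights_mul_heatKernel ht y 0 N
  refine ⟨2 ^ N * C, fun z => ?_⟩
  have hK : 0 ≤ heatKernel t (y - z) := (Literature.Analysis.UnboundedOperators.heatKernel_pos ht (y - z)).le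
  have h1 := one_add_norm_pow_le z N
  have h2 := hC z
  simp only [pow_zero, one_mul] at h2
  calc (1 + ‖z‖) ^ N * heatKernel t (y - z) ≤ (2 ^ N * (1 + ‖z‖ ^ 2) ^ N) * heatKernel t (y - z) :=
        by gcongr
    _ = 2 ^ N * ((1 + ‖z‖ ^ 2) ^ N * heatKernel t (y - z)) := by ring
    _ ≤ 2 ^ N * C := by gcongr

/-- For `t > 0` and fixed `y`, `(1 + ‖z‖²)^N K_t(y - z)` is bounded in `z`. [folklore] -/
theorem exists_bound_one_add_norm_sq_pow_mul_heatKernel [FiniteDimensional ℝ E] {t : ℝ}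
    (ht : 0 < t) (y : E) (N : ℕ) :
    ∃ C : ℝ, ∀ z : E, (1 + ‖z‖ ^ 2) ^ N * heatKernel t (y - z) ≤ C := by
  obtain ⟨C, hC⟩ := exists_bound_weights_mul_heatKernel ht y 0 N
  exact ⟨C, fun z => by simpa using hC z⟩

/-- For `t > 0` and fixed `y`, `(1 + ‖z‖)^N (1 + ‖y - z‖²) K_t(y - z)` is bounded in `z`
(the extra factor absorbs `‖y - z‖` from `∇K_t`). [folklore] -/
theorem exists_bound_one_add_norm_pow_mul_mul_heatKernel [FiniteDimensional ℝ E] {t : ℝ}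
    (ht : 0 < t) (y : E) (N : ℕ) :
    ∃ C : ℝ, ∀ z : E, (1 + ‖z‖) ^ N * ((1 + ‖y - z‖ ^ 2) * heatKernel t (y - z)) ≤ C := by
  obtain ⟨C, hC⟩ := exists_bound_weights_mul_heatKernel ht y 1 N
  refine ⟨2 ^ N * C, fun z => ?_⟩
  have hK : 0 ≤ heatKernel t (y - z) := (Literature.Analysis.UnboundedOperators.heatKernel_pos ht (y - z)).le
  have h1 := one_add_norm_pow_le z N
  have h2 := hC z
  simp only [pow_one] at h2
  calc (1 + ‖z‖) ^ N * ((1 + ‖y - z‖ ^ 2) * heatKernel t (y - z))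
      ≤ (2 ^ N * (1 + ‖z‖ ^ 2) ^ N) * ((1 + ‖y - z‖ ^ 2) * heatKernel t (y - z)) := by
        gcongr
    _ = 2 ^ N * ((1 + ‖y - z‖ ^ 2) * (1 + ‖z‖ ^ 2) ^ N * heatKernel t (y - z)) := by ring
    _ ≤ 2 ^ N * C := by gcongr


end Decay



/-! ### Cut-off functions -/

section Cutoff

variable {E : Type*} [NormedAddCommGroup E] [InnerProductSpace ℝ E] [FiniteDimensional ℝ E]

variable (β : ContDiffBump (0 : E))

/-- The cut-offs `χ_n(z) = β(z / (n+1))` built from a bump `β` are smooth. [folklore] -/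
theorem contDiff_cutoff (n : ℕ) : ContDiff ℝ ((⊤ : ℕ∞) : WithTop ℕ∞) (fun z : E => β (((n : ℝ) + 1)⁻¹ • z)) :=
  β.contDiff.comp (contDiff_const_smul _)

/-- The cut-offs `χ_n` are continuous. [folklore] -/
theorem continuous_cutoff (n : ℕ) : Continuous (fun z : E => β (((n : ℝ) + 1)⁻¹ • z)) :=
  (contDiff_cutoff β n).continuous

/-- `|χ_n| ≤ 1`. [folklore] -/
theorem abs_cutoff_le_one (n : ℕ) (z : E) : |β (((n : ℝ) + 1)⁻¹ • z)| ≤ 1 := by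
  rw [abs_of_nonneg (β.nonneg)]
  exact β.le_one

/-- `χ_n = 1` on the closed ball `B(0, r_in (n+1))`. [folklore] -/
theorem cutoff_eq_one_of_norm_le {n : ℕ} {z : E} (hz : ‖z‖ ≤ β.rIn * (n + 1)) :
    β (((n : ℝ) + 1)⁻¹ • z) = 1 := by
  refine β.one_of_mem_closedBall ?_
  rw [mem_closedBall_zero_iff, norm_smul, norm_inv, Real.norm_of_nonneg (by positivity)]
  rw [inv_mul_le_iff₀ (by positivity)]
  linarith

/-- `χ_n = 0` outside the ball `B(0, r_out (n+1))`. [folklore] -/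
theorem cutoff_eq_zero_of_le_norm {n : ℕ} {z : E} (hz : β.rOut * ((n : ℝ) + 1) ≤ ‖z‖) :
    β (((n : ℝ) + 1)⁻¹ • z) = 0 := by
  refine β.zero_of_le_dist ?_
  rw [dist_zero_right, norm_smul, norm_inv, Real.norm_of_nonneg (by positivity)]
  rw [le_inv_mul_iff₀ (by positivity)]
  linarith

/-- The cut-offs `χ_n` have compact support. [folklore] -/
theorem hasCompactSupport_cutoff (n : ℕ) : HasCompactSupport (fun z : E => β (((n : ℝ) + 1)⁻¹ • z)) := by
  refine HasCompactSupport.intro (isCompact_closedBall (0 : E) (β.rOut * ((n : ℝ) + 1))) ?_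
  intro z hz
  rw [mem_closedBall_zero_iff, not_le] at hz
  exact cutoff_eq_zero_of_le_norm β hz.le

/-- The cut-offs are eventually `1` at every point. [folklore] -/
theorem eventually_cutoff_eq_one (z : E) : ∀ᶠ n : ℕ in atTop, β (((n : ℝ) + 1)⁻¹ • z) = 1 := by
  obtain ⟨N, hN⟩ := exists_nat_ge (‖z‖ / β.rIn)
  filter_upwards [eventually_ge_atTop N] with n hn
  refine cutoff_eq_one_of_norm_le β ?_
  have h1 : (N : ℝ) ≤ n := by exact_mod_cast hn
  rw [div_le_iff₀ β.rIn_pos] at hN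
  nlinarith [β.rIn_pos]

/-- `χ_n → 1` pointwise. [folklore] -/
theorem tendsto_cutoff (z : E) : Tendsto (fun n : ℕ => β (((n : ℝ) + 1)⁻¹ • z)) atTop (𝓝 1) :=
  tendsto_const_nhds.congr' (by
    filter_upwards [eventually_cutoff_eq_one β z] with n hn
    exact hn.symm)

/-- The derivative of the cut-off vanishes on `B(0, n+1)`. [folklore] -/
theorem fderiv_cutoff_eq_zero {n : ℕ} {z : E} (hz : ‖z‖ < β.rIn * (n + 1)) :
    fderiv ℝ (fun z : E => β (((n : ℝ) + 1)⁻¹ • z)) z = 0 := by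
  have h : (fun z : E => β (((n : ℝ) + 1)⁻¹ • z)) =ᶠ[𝓝 z] fun _ => 1 := by
    have ho : IsOpen (ball (0 : E) (β.rIn * ((n : ℝ) + 1))) := isOpen_ball
    filter_upwards [ho.mem_nhds (mem_ball_zero_iff.mpr hz)] with w hw
    exact cutoff_eq_one_of_norm_le β (mem_ball_zero_iff.mp hw).le
  rw [h.fderiv_eq]
  simp

/-- `∇χ_n(z) = 0` for all large `n` (pointwise). [folklore] -/
theorem eventually_fderiv_cutoff_eq_zero (z : E) : ∀ᶠ n : ℕ in atTop, fderiv ℝ (fun z : E => β (((n : ℝ) + 1)⁻¹ • z)) z = 0 := by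
  obtain ⟨N, hN⟩ := exists_nat_ge (‖z‖ / β.rIn)
  filter_upwards [eventually_ge_atTop N] with n hn
  refine fderiv_cutoff_eq_zero β ?_
  have h1 : (N : ℝ) ≤ n := by exact_mod_cast hn
  rw [div_le_iff₀ β.rIn_pos] at hN
  nlinarith [β.rIn_pos]

/-- The derivatives of the cut-offs are bounded uniformly in `n`. [folklore] -/
theorem exists_bound_fderiv_cutoff :
    ∃ M : ℝ, ∀ (n : ℕ) (z : E), ‖fderiv ℝ (fun z : E => β (((n : ℝ) + 1)⁻¹ • z)) z‖ ≤ M := by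
  have hcont : Continuous (fderiv ℝ (β : E → ℝ)) :=
    (β.contDiff (n := ⊤)).continuous_fderiv (by simp)
  obtain ⟨M, hM⟩ := hcont.bounded_above_of_compact_support (β.hasCompactSupport.fderiv ℝ)
  have hM0 : 0 ≤ M := (norm_nonneg _).trans (hM 0)
  refine ⟨M, fun n z => ?_⟩
  have hd : HasFDerivAt (fun z : E => β (((n : ℝ) + 1)⁻¹ • z))
      ((fderiv ℝ (β : E → ℝ) (((n : ℝ) + 1)⁻¹ • z)).comp (((n : ℝ) + 1)⁻¹ • ContinuousLinearMap.id ℝ E)) z := by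
    have h1 : HasFDerivAt (β : E → ℝ) (fderiv ℝ (β : E → ℝ) (((n : ℝ) + 1)⁻¹ • z))
        (((n : ℝ) + 1)⁻¹ • z) :=
      ((β.contDiff (n := ⊤)).differentiable (by simp) _).hasFDerivAt
    have h2 : HasFDerivAt (fun z : E => ((n : ℝ) + 1)⁻¹ • z)
        (((n : ℝ) + 1)⁻¹ • ContinuousLinearMap.id ℝ E) z :=
      (((n : ℝ) + 1)⁻¹ • ContinuousLinearMap.id ℝ E).hasFDerivAt
    exact h1.comp z h2
  rw [hd.fderiv]
  calc ‖(fderiv ℝ (β : E → ℝ) (((n : ℝ) + 1)⁻¹ • z)).comp (((n : ℝ) + 1)⁻¹ • ContinuousLinearMap.id ℝ E)‖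
      ≤ ‖fderiv ℝ (β : E → ℝ) (((n : ℝ) + 1)⁻¹ • z)‖ * ‖((n : ℝ) + 1)⁻¹ • ContinuousLinearMap.id ℝ E‖ :=
        ContinuousLinearMap.opNorm_comp_le _ _
    _ ≤ M * 1 := by
        refine mul_le_mul (hM _) ?_ (norm_nonneg _) hM0
        rw [norm_smul, norm_inv, Real.norm_of_nonneg (by positivity)]
        calc ((n : ℝ) + 1)⁻¹ * ‖ContinuousLinearMap.id ℝ E‖ ≤ 1 * 1 := by
              refine mul_le_mul ?_ ContinuousLinearMap.norm_id_le (norm_nonneg _) zero_le_one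
              exact inv_le_one_of_one_le₀ (by simp)
          _ = 1 := one_mul _
    _ = M := mul_one _

end Cutoff

/-! ### The kernel as a function of the integration variable -/

section Kernel

variable {E : Type*} [NormedAddCommGroup E] [InnerProductSpace ℝ E] [FiniteDimensional ℝ E]
  (β : ContDiffBump (0 : E))

/-- `z ↦ K_t(y - z)` has derivative `v ↦ -⟪∇K_t(y - z), v⟫` (chain rule with
`hasGradientAt_heatKernel`, Evans, *PDE*, §2.3.1). [folklore] -/
theorem hasFDerivAt_heatKernel_sub (t : ℝ) (y z : E) :
    HasFDerivAt (fun z => heatKernel t (y - z)) (-(innerSL ℝ (heatKernelGrad t (y - z)))) z := by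
  haveI : CompleteSpace E := FiniteDimensional.complete ℝ E
  have h1 := (hasGradientAt_heatKernel t (y - z)).hasFDerivAt
  have h2 : HasFDerivAt (fun x : E => y - x) (-(ContinuousLinearMap.id ℝ E)) z :=
    (hasFDerivAt_id z).const_sub y
  have h := h1.comp z h2
  refine h.congr_fderiv ?_
  ext v
  simp [InnerProductSpace.toDual_apply_apply]

omit [FiniteDimensional ℝ E] in
/-- `z ↦ K_t(y - z)` is smooth. [folklore] -/
theorem contDiff_heatKernel_sub (t : ℝ) (y : E) {n : WithTop ℕ∞} :
    ContDiff ℝ n (fun z : E => heatKernel t (y - z)) := by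
  unfold heatKernel
  exact contDiff_const.mul (Real.contDiff_exp.comp
    ((((contDiff_norm_sq ℝ).comp (contDiff_const.sub contDiff_id)).neg).div_const _))

omit [FiniteDimensional ℝ E] in
/-- `z ↦ K_t(y - z)` is continuous. [folklore] -/
theorem continuous_heatKernel_sub (t : ℝ) (y : E) : Continuous fun z : E => heatKernel t (y - z) :=
  (contDiff_heatKernel_sub t y (n := 0)).continuous

omit [FiniteDimensional ℝ E] in
/-- `z ↦ ∇K_t(y - z)` is continuous. [folklore] -/
theorem continuous_heatKernelGrad_sub (t : ℝ) (y : E) :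
    Continuous fun z : E => heatKernelGrad t (y - z) := by
  unfold heatKernelGrad
  exact ((continuous_const.mul (continuous_heatKernel_sub t y)).smul (continuous_const.sub continuous_id))

/-- The inner product with a gradient is the Fréchet derivative. [folklore] -/
theorem inner_gradient_eq_fderiv (φ : E → ℝ) (z v : E) : ⟪v, gradient φ z⟫ = fderiv ℝ φ z v := by
  haveI : CompleteSpace E := FiniteDimensional.complete ℝ E
  rw [gradient, real_inner_comm, InnerProductSpace.toDual_symm_apply]

/-- The test functions `φ_n(z) = χ_n(z) K_t(y - z)`. [folklore] -/
theorem isTestFunctionOn_cutoff_mul_heatKernel (n : ℕ) (t : ℝ) (y : E) :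
    IsTestFunctionOn ⊤ (fun z : E => β (((n : ℝ) + 1)⁻¹ • z) * heatKernel t (y - z)) where
  contDiff := (contDiff_cutoff β n).mul (contDiff_heatKernel_sub t y)
  hasCompactSupport := (hasCompactSupport_cutoff β n).mul_right
  tsupport_subset := by simp

/-- Derivative of the test functions `φ_n`. [folklore] -/
theorem hasFDerivAt_cutoff_mul_heatKernel (n : ℕ) (t : ℝ) (y z : E) :
    HasFDerivAt (fun z : E => β (((n : ℝ) + 1)⁻¹ • z) * heatKernel t (y - z))
      (β (((n : ℝ) + 1)⁻¹ • z) • (-(innerSL ℝ (heatKernelGrad t (y - z)))) +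
        heatKernel t (y - z) • fderiv ℝ (fun z : E => β (((n : ℝ) + 1)⁻¹ • z)) z) z := by
  have hc : HasFDerivAt (fun z : E => β (((n : ℝ) + 1)⁻¹ • z)) (fderiv ℝ (fun z : E => β (((n : ℝ) + 1)⁻¹ • z)) z) z :=
    (((contDiff_cutoff β n).differentiable (by simp)) z).hasFDerivAt
  exact hc.mul (hasFDerivAt_heatKernel_sub t y z)

/-- The derivative of `φ_n = χ_n K_t(y - ·)` applied to a vector:
`Dφ_n(z) v = -χ_n(z) ⟪∇K_t(y - z), v⟫ + K_t(y - z) Dχ_n(z) v`. [folklore] -/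
theorem fderiv_cutoff_mul_heatKernel_apply (n : ℕ) (t : ℝ) (y z v : E) :
    fderiv ℝ (fun z : E => β (((n : ℝ) + 1)⁻¹ • z) * heatKernel t (y - z)) z v =
      -(β (((n : ℝ) + 1)⁻¹ • z) * ⟪heatKernelGrad t (y - z), v⟫) +
        heatKernel t (y - z) * fderiv ℝ (fun z : E => β (((n : ℝ) + 1)⁻¹ • z)) z v := by
  rw [(hasFDerivAt_cutoff_mul_heatKernel β n t y z).fderiv]
  simp [innerSL_apply_apply]

end Kernel



/-! ### Integrability against the kernel and its gradient -/

section Main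

variable {E : Type*} [NormedAddCommGroup E] [InnerProductSpace ℝ E] [FiniteDimensional ℝ E]
  [MeasurableSpace E] [BorelSpace E]

omit [FiniteDimensional ℝ E] [MeasurableSpace E] [BorelSpace E] in
/-- `‖∇K_t(x)‖ ≤ (2t)⁻¹ (1 + ‖x‖²) K_t(x)`. [folklore] -/
theorem norm_heatKernelGrad_le {t : ℝ} (ht : 0 < t) (x : E) :
    ‖heatKernelGrad t x‖ ≤ (2 * t)⁻¹ * ((1 + ‖x‖ ^ 2) * heatKernel t x) := by
  have hK : 0 ≤ heatKernel t x := (Literature.Analysis.UnboundedOperators.heatKernel_pos ht x).le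
  rw [heatKernelGrad, norm_smul, norm_mul, norm_neg, norm_inv, Real.norm_of_nonneg (by positivity),
    Real.norm_of_nonneg hK]
  have h : ‖x‖ ≤ 1 + ‖x‖ ^ 2 := by nlinarith [norm_nonneg x, sq_nonneg (‖x‖ - 1)]
  have h2 : (2 * t)⁻¹ * heatKernel t x * ‖x‖ ≤ (2 * t)⁻¹ * heatKernel t x * (1 + ‖x‖ ^ 2) := by
    gcongr
  linarith [h2, show (2 * t)⁻¹ * heatKernel t x * (1 + ‖x‖ ^ 2) =
    (2 * t)⁻¹ * ((1 + ‖x‖ ^ 2) * heatKernel t x) from by ring]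

omit [MeasurableSpace E] [BorelSpace E] in
/-- For `t > 0` and fixed `y`, `(1 + ‖z‖)^N ‖∇K_t(y - z)‖` is bounded in `z`. [folklore] -/
theorem exists_bound_one_add_norm_pow_mul_norm_heatKernelGrad {t : ℝ} (ht : 0 < t) (y : E)
    (N : ℕ) : ∃ C : ℝ, ∀ z : E, (1 + ‖z‖) ^ N * ‖heatKernelGrad t (y - z)‖ ≤ C := by
  obtain ⟨C, hC⟩ := exists_bound_one_add_norm_pow_mul_mul_heatKernel ht y N
  refine ⟨(2 * t)⁻¹ * C, fun z => ?_⟩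
  have h1 : (1 + ‖z‖) ^ N * ‖heatKernelGrad t (y - z)‖ ≤
      (1 + ‖z‖) ^ N * ((2 * t)⁻¹ * ((1 + ‖y - z‖ ^ 2) * heatKernel t (y - z))) := by
    gcongr
    exact norm_heatKernelGrad_le ht _
  have h2 : (1 + ‖z‖) ^ N * ((2 * t)⁻¹ * ((1 + ‖y - z‖ ^ 2) * heatKernel t (y - z))) =
      (2 * t)⁻¹ * ((1 + ‖z‖) ^ N * ((1 + ‖y - z‖ ^ 2) * heatKernel t (y - z))) := by ring
  have h3 : (2 * t)⁻¹ * ((1 + ‖z‖) ^ N * ((1 + ‖y - z‖ ^ 2) * heatKernel t (y - z))) ≤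
      (2 * t)⁻¹ * C := by
    gcongr
    exact hC z
  linarith

/-- Integrability transfer: if `g / w ∈ L¹` and `w k ≤ C` with `k ≥ 0` continuous, then
`g k ∈ L¹`. [folklore] -/
theorem integrable_mul_of_weight_bound {g w k : E → ℝ} (hw : ∀ z, 0 < w z) (hwc : Continuous w)
    (hg : Integrable fun z => (w z)⁻¹ * g z) (hk : Continuous k) (hk0 : ∀ z, 0 ≤ k z)
    {C : ℝ} (hC : ∀ z, w z * k z ≤ C) : Integrable fun z => g z * k z := by
  have h := hg.bdd_mul (c := C) ((hwc.mul hk).aestronglyMeasurable)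
    (Eventually.of_forall fun z => by
      show ‖w z * k z‖ ≤ C
      rw [Real.norm_of_nonneg (mul_nonneg (hw z).le (hk0 z))]
      exact hC z)
  refine h.congr (Eventually.of_forall fun z => ?_)
  show w z * k z * ((w z)⁻¹ * g z) = g z * k z
  field_simp [(hw z).ne']

/-- `u K_t(y - ·) ∈ L¹` for polynomially integrable `u`. [folklore] -/
theorem integrable_mul_heatKernel {u : E → ℝ} {N : ℕ}
    (hu : Integrable fun z => ((1 + ‖z‖ ^ 2) ^ N)⁻¹ * u z) {t : ℝ} (ht : 0 < t) (y : E) :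
    Integrable fun z => u z * heatKernel t (y - z) := by
  obtain ⟨C, hC⟩ := exists_bound_one_add_norm_sq_pow_mul_heatKernel ht y N
  exact integrable_mul_of_weight_bound (fun z => by positivity) (by fun_prop) hu
    (continuous_heatKernel_sub t y) (fun z => show 0 ≤ heatKernel t (y - z) from (Literature.Analysis.UnboundedOperators.heatKernel_pos ht _).le) hC

/-- `‖Φ‖ K_t(y - ·) ∈ L¹` for `Φ` of Stein growth. [folklore] -/
theorem integrable_norm_mul_heatKernel {Φ : E → E} {N : ℕ}
    (hΦ : Integrable fun z => ((1 + ‖z‖) ^ N)⁻¹ * ‖Φ z‖) {t : ℝ} (ht : 0 < t) (y : E) :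
    Integrable fun z => ‖Φ z‖ * heatKernel t (y - z) := by
  obtain ⟨C, hC⟩ := exists_bound_one_add_norm_pow_mul_heatKernel ht y N
  exact integrable_mul_of_weight_bound (fun z => by positivity) (by fun_prop) hΦ
    (continuous_heatKernel_sub t y) (fun z => show 0 ≤ heatKernel t (y - z) from (Literature.Analysis.UnboundedOperators.heatKernel_pos ht _).le) hC

/-- `‖Φ‖ ‖∇K_t(y - ·)‖ ∈ L¹` for `Φ` of Stein growth. [folklore] -/
theorem integrable_norm_mul_norm_heatKernelGrad {Φ : E → E} {N : ℕ}
    (hΦ : Integrable fun z => ((1 + ‖z‖) ^ N)⁻¹ * ‖Φ z‖) {t : ℝ} (ht : 0 < t) (y : E) :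
    Integrable fun z => ‖Φ z‖ * ‖heatKernelGrad t (y - z)‖ := by
  obtain ⟨C, hC⟩ := exists_bound_one_add_norm_pow_mul_norm_heatKernelGrad ht y N
  exact integrable_mul_of_weight_bound (fun z => by positivity) (by fun_prop) hΦ
    (continuous_heatKernelGrad_sub t y).norm (fun z => norm_nonneg _) hC

/-- The norm of a vector field is weighted-integrable when its components are. [folklore] -/
theorem integrable_weight_mul_norm_of_components {ι : Type*} [Fintype ι] {Φ : E → E}
    (hΦm : AEStronglyMeasurable Φ volume) {w : E → ℝ} (hw : Continuous w)
    (b : OrthonormalBasis ι ℝ E) (h : ∀ i, Integrable fun z => w z * ⟪Φ z, b i⟫) :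
    Integrable fun z => w z * ‖Φ z‖ := by
  refine Integrable.mono' (integrable_finsetSum Finset.univ fun i _ => (h i).norm)
    (hw.aestronglyMeasurable.mul hΦm.norm) (Eventually.of_forall fun z => ?_)
  rw [norm_mul, norm_norm]
  have h1 : ‖Φ z‖ ≤ ∑ i, ‖⟪Φ z, b i⟫‖ := by
    calc ‖Φ z‖ = ‖∑ i, ⟪b i, Φ z⟫ • b i‖ := by rw [b.sum_repr']
      _ ≤ ∑ i, ‖⟪b i, Φ z⟫ • b i‖ := norm_sum_le _ _
      _ = ∑ i, ‖⟪Φ z, b i⟫‖ := by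
          refine Finset.sum_congr rfl fun i _ => ?_
          rw [norm_smul, b.orthonormal.1 i, mul_one, real_inner_comm]
  calc ‖w z‖ * ‖Φ z‖ ≤ ‖w z‖ * ∑ i, ‖⟪Φ z, b i⟫‖ := by gcongr
    _ = ∑ i, ‖w z * ⟪Φ z, b i⟫‖ := by
        rw [Finset.mul_sum]
        refine Finset.sum_congr rfl fun i _ => ?_
        rw [norm_mul]

/-! ### The identity `e^{tΔ} div Φ = Σᵢ ∂ᵢ e^{tΔ} Φᵢ` -/

/-- **(C) as a theorem: the caloric extension of a weak divergence** (Koch–Tataru 2001, §4,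
proof of Theorem 1, first display, the identity `e^{tΔ} Σᵢ∂ᵢfⁱ = Σᵢ ∂ᵢe^{tΔ}fⁱ` behind
`|B|⁻¹∫ Σ|∂ᵢvⁱ|² ≤ Σ‖fⁱ‖²_BMO`): if `u = div Φ` weakly, `u` is integrable against a polynomial
weight and the components of `Φ` have Stein's growth `∫ |Φᵢ| (1+‖y‖)^{-(d+1)} < ∞`, then for
`t > 0` and every orthonormal basis `(bᵢ)`, `e^{tΔ}u (y) = Σᵢ ⟪∇e^{tΔ}⟪Φ, bᵢ⟫ (y), bᵢ⟫`.
Proof: test the weak identity with `χ_n K_t(y - ·)` and let `n → ∞` by dominated convergence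
(see the module docstring). [cite: KochTataruAdvMath2001, §4, proof of Theorem 1, first display] -/
theorem heatExtension_eq_sum_inner_heatExtensionGrad' {u : E → ℝ} {Φ : E → E}
    (hdiv : HasWeakDivergenceRepresentation u Φ)
    (htemp : ∃ N : ℕ, Integrable fun y => ((1 + ‖y‖ ^ 2) ^ N)⁻¹ * u y)
    (hΦ : ∀ v : E, Integrable fun y => ((1 + ‖y‖) ^ (Module.finrank ℝ E + 1))⁻¹ * ⟪Φ y, v⟫)
    (b : OrthonormalBasis (Fin (Module.finrank ℝ E)) ℝ E) {t : ℝ} (ht : 0 < t) (y : E) :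
    heatExtension u t y = ∑ i, ⟪heatExtensionGrad (fun z => ⟪Φ z, b i⟫) t y, b i⟫ := by
  obtain ⟨N, hN⟩ := htemp
  have hΦm : AEStronglyMeasurable Φ volume := hdiv.locallyIntegrable_field.aestronglyMeasurable
  have hum : AEStronglyMeasurable u volume := hdiv.locallyIntegrable.aestronglyMeasurable
  have hwc : Continuous fun z : E => ((1 + ‖z‖) ^ (Module.finrank ℝ E + 1))⁻¹ := by
    have hc : Continuous fun z : E => (1 + ‖z‖) ^ (Module.finrank ℝ E + 1) :=
      (continuous_const.add continuous_norm).pow _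
    exact hc.inv₀ fun z => (pow_pos (by linarith [norm_nonneg z]) _).ne'
  have hΦw : Integrable fun z => ((1 + ‖z‖) ^ (Module.finrank ℝ E + 1))⁻¹ * ‖Φ z‖ :=
    integrable_weight_mul_norm_of_components hΦm hwc b fun i => hΦ (b i)
  -- the kernels as functions of `z`
  have hKc : Continuous fun z : E => heatKernel t (y - z) := continuous_heatKernel_sub t y
  have hGc : Continuous fun z : E => heatKernelGrad t (y - z) := continuous_heatKernelGrad_sub t y
  have hK0 : ∀ z : E, 0 ≤ heatKernel t (y - z) := fun z => (Literature.Analysis.UnboundedOperators.heatKernel_pos ht _).le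
  -- integrability
  have hI1 : Integrable fun z => u z * heatKernel t (y - z) := integrable_mul_heatKernel hN ht y
  have hI2 : Integrable fun z => ‖Φ z‖ * heatKernel t (y - z) :=
    integrable_norm_mul_heatKernel hΦw ht y
  have hI3 : Integrable fun z => ‖Φ z‖ * ‖heatKernelGrad t (y - z)‖ :=
    integrable_norm_mul_norm_heatKernelGrad hΦw ht y
  -- cut-offs built from a bump function `β`
  obtain ⟨β⟩ : Nonempty (ContDiffBump (0 : E)) := ⟨⟨1, 2, zero_lt_one, one_lt_two⟩⟩
  obtain ⟨M, hM⟩ := exists_bound_fderiv_cutoff β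
  have hM0 : 0 ≤ M := (norm_nonneg _).trans (hM 0 0)
  -- measurability of the pieces
  have hmeas_inner : AEStronglyMeasurable (fun z => ⟪heatKernelGrad t (y - z), Φ z⟫) volume :=
    hGc.aestronglyMeasurable.inner hΦm
  have hmeas_fd : ∀ n : ℕ, AEStronglyMeasurable
      (fun z => heatKernel t (y - z) * fderiv ℝ (fun z : E => β (((n : ℝ) + 1)⁻¹ • z)) z (Φ z)) volume := by
    intro n
    refine hKc.aestronglyMeasurable.mul ?_
    have hc : Continuous (fderiv ℝ (fun z : E => β (((n : ℝ) + 1)⁻¹ • z))) :=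
      (contDiff_cutoff β n).continuous_fderiv (by simp)
    exact isBoundedBilinearMap_apply.continuous.comp_aestronglyMeasurable
      (hc.aestronglyMeasurable.prodMk hΦm)
  -- integrability of the pieces of the weak identity
  have hJ1 : ∀ n : ℕ, Integrable fun z => β (((n : ℝ) + 1)⁻¹ • z) * ⟪heatKernelGrad t (y - z), Φ z⟫ := by
    intro n
    refine hI3.mono' ((continuous_cutoff β n).aestronglyMeasurable.mul hmeas_inner)
      (Eventually.of_forall fun z => ?_)
    rw [norm_mul, Real.norm_eq_abs]
    calc |β (((n : ℝ) + 1)⁻¹ • z)| * ‖⟪heatKernelGrad t (y - z), Φ z⟫‖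
        ≤ 1 * (‖heatKernelGrad t (y - z)‖ * ‖Φ z‖) :=
          mul_le_mul (abs_cutoff_le_one β n z) (norm_inner_le_norm _ _) (norm_nonneg _) zero_le_one
      _ = ‖Φ z‖ * ‖heatKernelGrad t (y - z)‖ := by ring
  have hJ2 : ∀ n : ℕ, Integrable fun z => heatKernel t (y - z) * fderiv ℝ (fun z : E => β (((n : ℝ) + 1)⁻¹ • z)) z (Φ z) := by
    intro n
    refine (hI2.const_mul M).mono' (hmeas_fd n) (Eventually.of_forall fun z => ?_)
    rw [norm_mul, Real.norm_of_nonneg (hK0 z)]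
    calc heatKernel t (y - z) * ‖fderiv ℝ (fun z : E => β (((n : ℝ) + 1)⁻¹ • z)) z (Φ z)‖
        ≤ heatKernel t (y - z) * (M * ‖Φ z‖) := by
          gcongr
          · exact hK0 z
          · exact (ContinuousLinearMap.le_opNorm _ _).trans (mul_le_mul_of_nonneg_right (hM n z) (norm_nonneg _))
      _ = M * (‖Φ z‖ * heatKernel t (y - z)) := by ring
  -- the weak identity tested with `φ_n = χ_n K_t(y - ·)`
  have hweak : ∀ n : ℕ, ∫ z, u z * (β (((n : ℝ) + 1)⁻¹ • z) * heatKernel t (y - z)) =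
      (∫ z, β (((n : ℝ) + 1)⁻¹ • z) * ⟪heatKernelGrad t (y - z), Φ z⟫) -
        ∫ z, heatKernel t (y - z) * fderiv ℝ (fun z : E => β (((n : ℝ) + 1)⁻¹ • z)) z (Φ z) := by
    intro n
    rw [hdiv.integral_mul_eq _ (isTestFunctionOn_cutoff_mul_heatKernel β n t y)]
    have hpt : (fun z => ⟪Φ z, gradient (fun z => β (((n : ℝ) + 1)⁻¹ • z) * heatKernel t (y - z)) z⟫) =
        fun z => -(β (((n : ℝ) + 1)⁻¹ • z) * ⟪heatKernelGrad t (y - z), Φ z⟫) +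
          heatKernel t (y - z) * fderiv ℝ (fun z : E => β (((n : ℝ) + 1)⁻¹ • z)) z (Φ z) := by
      funext z
      rw [inner_gradient_eq_fderiv, fderiv_cutoff_mul_heatKernel_apply]
    have hJ1n : Integrable fun z => -(β (((n : ℝ) + 1)⁻¹ • z) * ⟪heatKernelGrad t (y - z), Φ z⟫) :=
      (hJ1 n).neg
    rw [hpt, integral_add hJ1n (hJ2 n), integral_neg]
    ring
  -- limit of the left-hand sides
  have hA : Tendsto (fun n : ℕ => ∫ z, u z * (β (((n : ℝ) + 1)⁻¹ • z) * heatKernel t (y - z))) atTop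
      (𝓝 (∫ z, u z * heatKernel t (y - z))) := by
    refine tendsto_integral_of_dominated_convergence (fun z => ‖u z * heatKernel t (y - z)‖)
      (fun n => hum.mul ((continuous_cutoff β n).mul hKc).aestronglyMeasurable) hI1.norm
      (fun n => Eventually.of_forall fun z => ?_) (Eventually.of_forall fun z => ?_)
    · rw [norm_mul, norm_mul, norm_mul, Real.norm_eq_abs (β (((n : ℝ) + 1)⁻¹ • z))]
      calc ‖u z‖ * (|β (((n : ℝ) + 1)⁻¹ • z)| * ‖heatKernel t (y - z)‖) ≤ ‖u z‖ * (1 * ‖heatKernel t (y - z)‖) := by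
            gcongr
            exact abs_cutoff_le_one β n z
        _ = ‖u z‖ * ‖heatKernel t (y - z)‖ := by rw [one_mul]
    · have h := ((tendsto_cutoff β z).mul_const (heatKernel t (y - z))).const_mul (u z)
      simpa using h
  -- limit of the first right-hand term
  have hB : Tendsto (fun n : ℕ => ∫ z, β (((n : ℝ) + 1)⁻¹ • z) * ⟪heatKernelGrad t (y - z), Φ z⟫) atTop
      (𝓝 (∫ z, ⟪heatKernelGrad t (y - z), Φ z⟫)) := by
    refine tendsto_integral_of_dominated_convergence (fun z => ‖Φ z‖ * ‖heatKernelGrad t (y - z)‖)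
      (fun n => (continuous_cutoff β n).aestronglyMeasurable.mul hmeas_inner) hI3
      (fun n => Eventually.of_forall fun z => ?_) (Eventually.of_forall fun z => ?_)
    · rw [norm_mul, Real.norm_eq_abs]
      calc |β (((n : ℝ) + 1)⁻¹ • z)| * ‖⟪heatKernelGrad t (y - z), Φ z⟫‖
          ≤ 1 * (‖heatKernelGrad t (y - z)‖ * ‖Φ z‖) :=
            mul_le_mul (abs_cutoff_le_one β n z) (norm_inner_le_norm _ _) (norm_nonneg _) zero_le_one
        _ = ‖Φ z‖ * ‖heatKernelGrad t (y - z)‖ := by ring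
    · have h := (tendsto_cutoff β z).mul_const ⟪heatKernelGrad t (y - z), Φ z⟫
      simpa using h
  -- the second right-hand term tends to zero
  have hC : Tendsto (fun n : ℕ => ∫ z, heatKernel t (y - z) * fderiv ℝ (fun z : E => β (((n : ℝ) + 1)⁻¹ • z)) z (Φ z)) atTop
      (𝓝 0) := by
    have h := tendsto_integral_of_dominated_convergence (F := fun (n : ℕ) z =>
        heatKernel t (y - z) * fderiv ℝ (fun z : E => β (((n : ℝ) + 1)⁻¹ • z)) z (Φ z)) (f := fun _ => 0)
      (μ := volume) (fun z => M * (‖Φ z‖ * heatKernel t (y - z)))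
      hmeas_fd (hI2.const_mul M)
      (fun n => Eventually.of_forall fun z => ?_) (Eventually.of_forall fun z => ?_)
    · simpa using h
    · rw [norm_mul, Real.norm_of_nonneg (hK0 z)]
      calc heatKernel t (y - z) * ‖fderiv ℝ (fun z : E => β (((n : ℝ) + 1)⁻¹ • z)) z (Φ z)‖
          ≤ heatKernel t (y - z) * (M * ‖Φ z‖) := by
            gcongr
            · exact hK0 z
            · exact (ContinuousLinearMap.le_opNorm _ _).trans (mul_le_mul_of_nonneg_right (hM n z) (norm_nonneg _))
        _ = M * (‖Φ z‖ * heatKernel t (y - z)) := by ring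
    · refine tendsto_const_nhds.congr' ?_
      filter_upwards [eventually_fderiv_cutoff_eq_zero β z] with n hn
      simp [hn]
  -- identification of the limits
  have hlim : Tendsto (fun n : ℕ => ∫ z, u z * (β (((n : ℝ) + 1)⁻¹ • z) * heatKernel t (y - z))) atTop
      (𝓝 ((∫ z, ⟪heatKernelGrad t (y - z), Φ z⟫) - 0)) := by
    rw [funext hweak]
    exact hB.sub hC
  have heq : ∫ z, u z * heatKernel t (y - z) = ∫ z, ⟪heatKernelGrad t (y - z), Φ z⟫ := by
    have := tendsto_nhds_unique hA hlim
    rw [this, sub_zero]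
  have hL : heatExtension u t y = ∫ z, u z * heatKernel t (y - z) := by
    unfold heatExtension
    congr 1
    funext z
    ring
  rw [hL, heq]
  -- the right-hand side
  have hint : ∀ i, Integrable fun z => ⟪Φ z, b i⟫ • heatKernelGrad t (y - z) := by
    intro i
    refine hI3.mono' ((hΦm.inner aestronglyMeasurable_const).smul hGc.aestronglyMeasurable)
      (Eventually.of_forall fun z => ?_)
    rw [norm_smul]
    gcongr
    calc ‖⟪Φ z, b i⟫‖ ≤ ‖Φ z‖ * ‖b i‖ := norm_inner_le_norm _ _
      _ = ‖Φ z‖ := by rw [b.orthonormal.1 i, mul_one]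
  have hint' : ∀ i, Integrable fun z => ⟪Φ z, b i⟫ * ⟪b i, heatKernelGrad t (y - z)⟫ := by
    intro i
    refine hI3.mono' ((hΦm.inner aestronglyMeasurable_const).mul
      (aestronglyMeasurable_const.inner hGc.aestronglyMeasurable))
      (Eventually.of_forall fun z => ?_)
    rw [norm_mul]
    calc ‖⟪Φ z, b i⟫‖ * ‖⟪b i, heatKernelGrad t (y - z)⟫‖
        ≤ (‖Φ z‖ * ‖b i‖) * (‖b i‖ * ‖heatKernelGrad t (y - z)‖) :=
          mul_le_mul (norm_inner_le_norm _ _) (norm_inner_le_norm _ _) (norm_nonneg _)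
            (by positivity)
      _ = ‖Φ z‖ * ‖heatKernelGrad t (y - z)‖ := by rw [b.orthonormal.1 i]; ring
  have h1 : ∀ i, ⟪heatExtensionGrad (fun z => ⟪Φ z, b i⟫) t y, b i⟫ =
      ∫ z, ⟪Φ z, b i⟫ * ⟪b i, heatKernelGrad t (y - z)⟫ := by
    intro i
    rw [heatExtensionGrad, real_inner_comm, ← integral_inner (hint i)]
    congr 1
    funext z
    rw [inner_smul_right]
  rw [Finset.sum_congr rfl fun i _ => h1 i, ← integral_finsetSum _ fun i _ => hint' i]
  congr 1
  funext z
  rw [b.sum_inner_mul_inner, real_inner_comm]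

end Main

end BMOInv


/-! ## Discharge of fact (C) and the assembly from (B), (D), (E) -/

section Assembly

variable {E : Type*} [NormedAddCommGroup E] [InnerProductSpace ℝ E] [FiniteDimensional ℝ E]
  [MeasurableSpace E] [BorelSpace E]

open BMOInv

/-- **Discharge of fact (C)** `heatExtension_eq_sum_inner_heatExtensionGrad`: the caloric
extension of a weak divergence is the sum of the directional caloric gradients of the components
(Koch–Tataru 2001, §4, proof of Theorem 1, first display). [cite: KochTataruAdvMath2001, §4, proof of Theorem 1, first display] -/
theorem heatExtension_eq_sum_inner_heatExtensionGrad_holds :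
    heatExtension_eq_sum_inner_heatExtensionGrad (E := E) :=
  fun hdiv htemp hΦ b _ ht y => heatExtension_eq_sum_inner_heatExtensionGrad' hdiv htemp hΦ b ht y

/-- The assembly with (A) discharged: Koch–Tataru's Theorem 1 from (B)–(E) alone. [cite: KochTataruAdvMath2001, Theorem 1] -/
theorem memBMOInv_iff_carleson_heat_of'
    (hB : eCarlesonGradNorm_le_of_memBMO (E := E))
    (hC : heatExtension_eq_sum_inner_heatExtensionGrad (E := E))
    (hD : exists_hasWeakDivergenceRepresentation_of_eCarlesonNorm_lt_top (E := E))
    (hE : memBMO_of_eCarlesonGradNorm_lt_top (E := E)) :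
    memBMOInv_iff_carleson_heat (E := E) :=
  memBMOInv_iff_carleson_heat_of MemBMO.integrable_inv_one_add_norm_pow_mul_holds hB hC hD hE

/-- **The assembly with (A) and (C) discharged**: Koch–Tataru's Theorem 1
(`memBMOInv_iff_carleson_heat`) follows from the harmonic-analysis core alone — (B) and (E), the
two directions of the Fefferman–Stein Carleson characterisation of `BMO` in heat form, and (D),
Koch–Tataru's converse in Carleson form (their Lemma 4.1). [cite: KochTataruAdvMath2001, Theorem 1] -/
theorem memBMOInv_iff_carleson_heat_of_BDE
    (hB : eCarlesonGradNorm_le_of_memBMO (E := E))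
    (hD : exists_hasWeakDivergenceRepresentation_of_eCarlesonNorm_lt_top (E := E))
    (hE : memBMO_of_eCarlesonGradNorm_lt_top (E := E)) :
    memBMOInv_iff_carleson_heat (E := E) :=
  memBMOInv_iff_carleson_heat_of MemBMO.integrable_inv_one_add_norm_pow_mul_holds hB
    heatExtension_eq_sum_inner_heatExtensionGrad_holds hD hE

end Assembly

end Literature.Analysis.FunctionSpaces
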